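/-
Copyright (c) 2026 the pub-hodgecm-mathlib formalisation cell (harness21).  Prover seat hodgecm-mathlib-K2E1-p15 (g3), Track B ∕ K2-LIT, h413 = `stmt-HodgeConjecture-24833`,
R90-TF section S8 «ContSpec-n½», #4′ road, MODEL-FAMILY brick item (α) (S8-R73 PICK 2026-09-04T22:50:21Z; census `R90/S8/CENSUS-SDM1.K2E1-p15-g3.md`): the SELF-DUAL block at the TOP
level `K_max = K_∞·K_max,f` (`χ∞ = 1`, `ω = 1`) IS left-modelled — the ★ letter-free M1 Plancherel isometry re-keyed to the block of record `resHBlock L μ K_max 1 χ` (ED. 1).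
-/
import Summits.HodgeConjecture.HodgeConjecture.Theorems.R90S8ResHBlockModelFamilyU2                       -- ★ p862602 (this seat): `sdModelMap_*`, `hLnU_sdModelMap`, `completeSpace_resHBlock` (+ ★ DEFS p862464)
import Summits.HodgeConjecture.HodgeConjecture.Theorems.K2E1ChiSectionPlancherelSelfDualM1CMTwoLetterFree   -- ★ p861360 (K2E1-p14): `exists_linearIsometry_chiSection_selfDual_m1_letterFree_cm_two` (the M1 SD isometry, letter-free)
import Summits.HodgeConjecture.HodgeConjecture.Theorems.K2E1ResidualBlockPackageSelfDualFamilyCMTwo         -- ★ p861419∕RUNG-1 (K2E4-p23): `topologicalClosure_span_bricks_eq_selfDual` (the block at `K_max` is the closed span of the rank-one family)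
import HarnessLib

/-!
# S8 #4′ road — `R90S8ResHBlockSelfDualModelM1U2`: at the top level `K_max` (`ω = 1`) the SELF-DUAL block `Sc(K_max, 1, χ)` carries the ★ letter-free M1 Plancherel isometry
# `Sc →ₗᵢ (⊕_{c ∈ S} W) ⊕₂ L²((0,∞); W)` — `model b = Sum.inl Uiso` for the self-dual blocks of the `χ∞ = 1` slice (MODEL-FAMILY (α), ED. 1)

Track B ∕ K2-LIT, crux h413 = `stmt-HodgeConjecture-24833`, route of record `HCCMUnconditional`; cell `hodgecm-mathlib`, R90-TF programme, section S8 «ContSpec-n½», socket #4′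
`sock_S8_resH_spannedByCharLines` (B ED. 4 :256).  THEOREMS ONLY (no `def`, no `instance`, no `notation`, no named-fact hypothesis, no `sorry`; default heartbeats); lane
`--supports stmt-HodgeConjecture-24833 --as helper` (count-neutral).  CLOSES NO SOCKET.  It instantiates, at ONE level family (the top Λ′ level `Kad K₀ = K_max`, ★
`maximalLevel_eq_closure_arch_fin_std`, trivial `K_∞`-type), the SELF-DUAL half of ★ `exists_blockModelFamily` (p862602 §6): for a unitary ray-trivial SELF-DUAL `χ` the block
`resHBlock L μ K_max 1 χ` carries the M1 Plancherel isometry of ★ `exists_linearIsometry_chiSection_selfDual_m1_letterFree_cm_two` (K2E1-p14, letter-free), so `model b = Sum.inl Uiso` there.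
VISIBLE BINDERS = the RUNG-1 structural binders only (Haar ∕ fundamental-domain data `νG μK νI 𝓕I ν 𝓕`, covering weight `β` with its Borel-quotient measure `μZ`, a normalised section `φ₀` of the
line `V(χ, K_max, 1)` with its `L²(K_max)` representative `v`, representatives `y_f` of the bricks `[θ_{f,φ₀}]` over the `C²_c((0,∞))` profiles, `σ₀ > 1`) — no analytic letter.

THE MATHEMATICS ([MoeglinWaldspurger1995, II.1.7, II.2.4, IV.1.10, IV.3.12]; [Langlands1976, §7]).  At the maximal level the section space `V(χ, K_max, 1)` is a LINE `ℂ·φ₀` (★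
`eq_smul_of_mem_chiSectionSpace_maximalLevel`), so the block `Sc(K_max, 1, χ)` — closed span of ALL continuous-profile bricks `[θ_{f,φ}]` — is the closed span of the rank-one family
`[θ_{f,φ₀}]`, `f ∈ C²_c((0,∞))` (★ `topologicalClosure_span_bricks_eq_selfDual`); on that closed span ★ M1 builds the isometry `U[θ_{f,φ₀}] = (r′_f, √(C∕2π)·w_f)` with residue coordinates
`r′_f ∈ ⊕_{c∈S} W` at the real poles `S ⊂ (½, σ₀)` of the scattering scalar `s` (meromorphic in normal form, analytic off a closed `P ⊆ {Re ≤ 1}`, residues `ρ_c ≥ 0`) and axis coordinate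
`w_f(t) = f̃(−½−it)φ₀ + s(½−it) f̃(−½+it)φ₀`.  Transport along the equality of closed subspaces (Mathlib `LinearIsometryEquiv.ofEq`) puts `U` on `resHBlock L μ K_max 1 χ`.
* §1 `resHBlock_maximalLevel_one_eq_topologicalClosure_span_range` — `resHBlock L μ K_max 1 χ = closure span (range y)` for any family of representatives `y_f =ᵐ quotFun θ_{f,φ₀}`.
* §2 **`exists_selfDual_isometry_resHBlock_m1`** — `∃ s P C S ρ r′ w (Uiso : ↥(resHBlock L μ K_max 1 χ) →ₗᵢ …)` with ★ M1's package clauses VERBATIM (`α := Unit`, `c := 1`) and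
  `Uiso ⟨y_f, _⟩ = toLp (r′_f, √(C∕2π) • w_f)`; `y_f ∈ resHBlock …` exported.  CONSUMER: `model b := Sum.inl Uiso` in ★ `exists_blockModelFamily`; `hLnU` by ★ `hLnU_sdModelMap`.
ED. 2 (booked): the intertwining `U(R(η)v) = (s(c)•, s(½+i·)•) U v` by ★ `exists_selfDual_modelMap_intertwining` (letters `η ŝ hact`) and `hline` by ★ `volume_levelSet_axis_eq_zero` + ★
`exists_symbol_ne_of_re_ge_half`.
HONEST LABEL: HC_CM is proved only modulo the 7 printed citations (2 remaining named inputs: hLiu418 = `stmt-HodgeConjecture-24832`, h413 = `stmt-HodgeConjecture-24833`) until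
rung 0 closes; REL ≠ ★ ≠ BUILT; this file asserts no named fact, instantiates ONE level family, and closes no socket; count-neutral.

## References
* [MoeglinWaldspurger1995] C. Mœglin, J.-L. Waldspurger, *Spectral Decomposition and Eisenstein Series* (1995), II.1.7, II.2.4, IV.1.10, IV.3.12.
* [Langlands1976] R. P. Langlands, *On the Functional Equations Satisfied by Eisenstein Series*, LNM 544 (1976), §7.
-/

set_option autoImplicit false
set_option linter.dupNamespace false  -- the mandated namespace `…HodgeConjecture.HodgeConjecture.R90.S8` (LEAD #1 L1) repeats the summit's segment

noncomputable section

open MeasureTheory MeasureTheory.Measure Set NumberField IsDedekindDomain Filter Topology Complex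
open scoped Real NNReal ENNReal ComplexConjugate InnerProductSpace BigOperators
open Literature.MeasureTheory.Group Literature.NumberTheory
open Literature.NumberTheory.Automorphic Literature.NumberTheory.Automorphic.UnitaryGroup AdelicGroupData
open Literature.NumberTheory.GaloisRepresentations
open Summit.HodgeConjecture.HodgeConjecture.Cruxes.H413.K2E1BorelEisensteinU
open Summit.HodgeConjecture.HodgeConjecture.Cruxes.H413.K2E1BLBorelSpacesU2Defs
open Summit.HodgeConjecture.HodgeConjecture.Cruxes.H413.K2E1BLBorelOperatorsU2Defs
open Summit.HodgeConjecture.HodgeConjecture.Cruxes.H413.K2E1CharacterEisensteinU2Defs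
open Summit.HodgeConjecture.HodgeConjecture.Cruxes.H413.K2E1ChiSectionSpaceU2Defs
open Summit.HodgeConjecture.HodgeConjecture.Cruxes.H413.K2E1ChiSectionPlancherelSelfDualM1CMTwoLetterFree (exists_linearIsometry_chiSection_selfDual_m1_letterFree_cm_two)
open Summit.HodgeConjecture.HodgeConjecture.Cruxes.H413.K2E1ResidualBlockPackageSelfDualFamilyCMTwo (topologicalClosure_span_bricks_eq_selfDual)
open Summit.HodgeConjecture.HodgeConjecture.Cruxes.H413.K2E1PlancherelIsometryOfForm (mem_topologicalClosure_span)

namespace Summit.HodgeConjecture.HodgeConjecture.R90.S8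

variable (L : Type) [Field L] [NumberField L] [IsCMField L]
  [MeasurableSpace (quasiSplit (↥(maximalRealSubfield L)) L (IsCMField.complexConj L) 2).Adelic] [BorelSpace (quasiSplit (↥(maximalRealSubfield L)) L (IsCMField.complexConj L) 2).Adelic]
  [MeasurableSpace (AdeleRing (𝓞 L) L)ˣ] [BorelSpace (AdeleRing (𝓞 L) L)ˣ]
  (μ : Measure (quasiSplit (↥(maximalRealSubfield L)) L (IsCMField.complexConj L) 2).automorphicQuotient) [(quasiSplit (↥(maximalRealSubfield L)) L (IsCMField.complexConj L) 2).IsAutomorphicMeasure μ]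

/-! ## §1 The block at `K_max`, `ω = 1`, is the closed span of the rank-one brick family -/

omit [MeasurableSpace (AdeleRing (𝓞 L) L)ˣ] [BorelSpace (AdeleRing (𝓞 L) L)ˣ] in
/-- **`resHBlock L μ K_max 1 χ = closure span (range y)`** for every family `y_f =ᵐ quotFun θ_{f,φ₀}` over the `C²_c((0,∞))` profiles (`φ₀ ∈ V(χ, K_max, 1)` continuous, `φ₀(1) ≠ 0`, `χ` unitary):
★ `topologicalClosure_span_bricks_eq_selfDual` (rank one at the maximal level) read through `resHBlock_def` (`ω := 1` as a hom coerces to the function `1`).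
[cite: MoeglinWaldspurger1995, II.1.7, II.2.4] -/
theorem resHBlock_maximalLevel_one_eq_topologicalClosure_span_range {χ : HeckeCharacter L} (hχu : χ.IsUnitary)
    {φ : (quasiSplit (↥(maximalRealSubfield L)) L (IsCMField.complexConj L) 2).Adelic → ℂ}
    (hφV : φ ∈ chiSectionSpace χ ((standardMaximalCompactGL 2 L).comap (adelicVal (↥(maximalRealSubfield L)) L (IsCMField.complexConj L) 2 ((StdForm.antidiagonal 2).over L)) : Subgroup (quasiSplit (↥(maximalRealSubfield L)) L (IsCMField.complexConj L) 2).Adelic) 1)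
    (hφc : Continuous φ) (hφ1 : φ 1 ≠ 0)
    (y : ↥{f : ℝ → ℂ | ContDiff ℝ 2 f ∧ HasCompactSupport f ∧ tsupport f ⊆ Ioi 0} → (quasiSplit (↥(maximalRealSubfield L)) L (IsCMField.complexConj L) 2).L2 μ)
    (hy : ∀ i, (y i : (quasiSplit (↥(maximalRealSubfield L)) L (IsCMField.complexConj L) 2).automorphicQuotient → ℂ) =ᵐ[μ]
      (quasiSplit (↥(maximalRealSubfield L)) L (IsCMField.complexConj L) 2).quotFun (eisensteinSeriesU (fun g : (quasiSplit (↥(maximalRealSubfield L)) L (IsCMField.complexConj L) 2).Adelic => (i : ℝ → ℂ) (borelHeight g : ℝ) * ((1 : ℂ) • φ) g))) :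
    resHBlock L μ ((standardMaximalCompactGL 2 L).comap (adelicVal (↥(maximalRealSubfield L)) L (IsCMField.complexConj L) 2 ((StdForm.antidiagonal 2).over L))) 1 χ =
      (Submodule.span ℂ (Set.range y)).topologicalClosure := by
  have h := topologicalClosure_span_bricks_eq_selfDual L μ hχu hφV hφc hφ1 rfl (fun i (_ : Unit) => y i) (fun i _ => hy i)
  have hsum : (fun i : ↥{f : ℝ → ℂ | ContDiff ℝ 2 f ∧ HasCompactSupport f ∧ tsupport f ⊆ Ioi 0} => ∑ a : Unit, (fun (i : ↥{f : ℝ → ℂ | ContDiff ℝ 2 f ∧ HasCompactSupport f ∧ tsupport f ⊆ Ioi 0}) (_ : Unit) => y i) i a) = y :=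
    funext fun i => Fintype.sum_unique _
  rw [hsum] at h
  rw [resHBlock_def, show ((1 : ↥((standardMaximalCompactGL 2 L).comap (adelicVal (↥(maximalRealSubfield L)) L (IsCMField.complexConj L) 2 ((StdForm.antidiagonal 2).over L)) : Subgroup (quasiSplit (↥(maximalRealSubfield L)) L (IsCMField.complexConj L) 2).Adelic) →* ℂ) :
      ↥((standardMaximalCompactGL 2 L).comap (adelicVal (↥(maximalRealSubfield L)) L (IsCMField.complexConj L) 2 ((StdForm.antidiagonal 2).over L)) : Subgroup (quasiSplit (↥(maximalRealSubfield L)) L (IsCMField.complexConj L) 2).Adelic) → ℂ) = 1 from rfl]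
  exact h

/-! ## §2 The self-dual M1 isometry on the block of record -/

/-- **THE SELF-DUAL BLOCK AT `K_max` IS LEFT-MODELLED (★ M1, letter-free, re-keyed)**: for `χ` unitary, ray-trivial and SELF-DUAL, a normalised section `φ₀` of the line `V(χ, K_max, 1)` with its
`L²(K_max)` representative `v`, representatives `y_f` of the bricks, the RUNG-1 structural data and `σ₀ > 1`, there are the M1 scattering package `(s, P, C, S, ρ)`, coordinates `r′ w`, and a
LINEAR ISOMETRY `Uiso : resHBlock L μ K_max 1 χ →ₗᵢ (⊕_{c∈S} W) ⊕₂ L²((0,∞); W)` (`W = ℂ·v`) with ★ M1's clauses verbatim (`α := Unit`, `c := 1`) and `Uiso ⟨y_f, _⟩ = toLp (r′_f, √(C∕2π)•w_f)`.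
So `model b = Sum.inl Uiso` for this block in ★ `exists_blockModelFamily`, and `hLnU` is ★ `hLnU_sdModelMap`. [cite: MoeglinWaldspurger1995, II.1.7, IV.1.10, IV.3.12] [cite: Langlands1976, §7] -/
theorem exists_selfDual_isometry_resHBlock_m1
    (νG : Measure (quasiSplit (↥(maximalRealSubfield L)) L (IsCMField.complexConj L) 2).Adelic) [νG.IsHaarMeasure] [νG.IsInvInvariant] [SFinite νG]
    (μK : Measure ↥((standardMaximalCompactGL 2 L).comap (adelicVal (↥(maximalRealSubfield L)) L (IsCMField.complexConj L) 2 ((StdForm.antidiagonal 2).over L)) : Subgroup (quasiSplit (↥(maximalRealSubfield L)) L (IsCMField.complexConj L) 2).Adelic)) [μK.IsHaarMeasure]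
    (νI : Measure (AdeleRing (𝓞 L) L)ˣ) [νI.IsHaarMeasure]
    {𝓕I : Set (AdeleRing (𝓞 L) L)ˣ} (h𝓕I : IsIdeleClassDomain L 𝓕I)
    (ν : Measure ↥(adelicUnipotent (↥(maximalRealSubfield L)) L (IsCMField.complexConj L) 2)) [ν.IsHaarMeasure] [ν.IsMulRightInvariant] [ν.IsInvInvariant]
    {𝓕 : Set ↥(adelicUnipotent (↥(maximalRealSubfield L)) L (IsCMField.complexConj L) 2)} (h𝓕N : IsFundamentalDomain ↥(rationalUnipotent (↥(maximalRealSubfield L)) L (IsCMField.complexConj L) 2) 𝓕 ν) (h𝓕1 : ν 𝓕 = 1)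
    (h𝓕c : IsCompact (closure 𝓕))
    {β : (quasiSplit (↥(maximalRealSubfield L)) L (IsCMField.complexConj L) 2).Adelic → ℝ≥0∞} (hβ : IsCoveringWeight ↥((arithmeticBorel (↥(maximalRealSubfield L)) L (IsCMField.complexConj L) 2).map (quasiSplit (↥(maximalRealSubfield L)) L (IsCMField.complexConj L) 2).arithmeticSubgroup.subtype) β)
    {μZ : Measure (borelQuotient (↥(maximalRealSubfield L)) L (IsCMField.complexConj L) 2)} [SFinite μZ]
    (hμZ : ∀ f : borelQuotient (↥(maximalRealSubfield L)) L (IsCMField.complexConj L) 2 → ℝ≥0∞, Measurable f → ∫⁻ z, f z ∂μZ = ∫⁻ g, β g * f (toBorelQuotient (↥(maximalRealSubfield L)) L (IsCMField.complexConj L) 2 g) ∂νG)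
    {χ : HeckeCharacter L} (hχ : χ.IsUnitary) (hρ : ∀ r : ℝ≥0ˣ, χ (posRealIdele L r) = 1) (hsd : reflectChar (IsCMField.complexConj L) χ = χ)
    {φ : (quasiSplit (↥(maximalRealSubfield L)) L (IsCMField.complexConj L) 2).Adelic → ℂ} (hφV : φ ∈ chiSectionSpace χ ((standardMaximalCompactGL 2 L).comap (adelicVal (↥(maximalRealSubfield L)) L (IsCMField.complexConj L) 2 ((StdForm.antidiagonal 2).over L)) : Subgroup (quasiSplit (↥(maximalRealSubfield L)) L (IsCMField.complexConj L) 2).Adelic) (fun _ => 1)) (hφc : Continuous φ) {Mφ : ℝ} (hφM : ∀ x, ‖φ x‖ ≤ Mφ)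
    (hφinf : ∀ a : arch (↥(maximalRealSubfield L)) L (IsCMField.complexConj L) 2 ((StdForm.antidiagonal 2).over L), φ (archToAdelic (↥(maximalRealSubfield L)) L (IsCMField.complexConj L) 2 _ a) = φ 1)
    (hφ1 : φ 1 ≠ 0) (hφ1r : conj (φ 1) = φ 1)
    (v : Lp ℂ 2 μK) (hv : ((v : Lp ℂ 2 μK) : ↥((standardMaximalCompactGL 2 L).comap (adelicVal (↥(maximalRealSubfield L)) L (IsCMField.complexConj L) 2 ((StdForm.antidiagonal 2).over L)) : Subgroup (quasiSplit (↥(maximalRealSubfield L)) L (IsCMField.complexConj L) 2).Adelic) → ℂ) =ᵐ[μK]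
      fun k => φ (k : (quasiSplit (↥(maximalRealSubfield L)) L (IsCMField.complexConj L) 2).Adelic))
    (y : ↥{f : ℝ → ℂ | ContDiff ℝ 2 f ∧ HasCompactSupport f ∧ tsupport f ⊆ Ioi 0} → Lp ℂ 2 μ)
    (hy : ∀ i, ((y i : Lp ℂ 2 μ) : (quasiSplit (↥(maximalRealSubfield L)) L (IsCMField.complexConj L) 2).automorphicQuotient → ℂ) =ᵐ[μ]
      (quasiSplit (↥(maximalRealSubfield L)) L (IsCMField.complexConj L) 2).quotFun (eisensteinSeriesU (fun g : (quasiSplit (↥(maximalRealSubfield L)) L (IsCMField.complexConj L) 2).Adelic => (i : ℝ → ℂ) (borelHeight g : ℝ) * ((1 : ℂ) • φ) g)))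
    {σ₀ : ℝ} (hσ₀ : 1 < σ₀) :
    ∃ (s : ℂ → ℂ) (P : Set ℂ) (C : ℝ) (S : Finset ℝ) (ρ : ℝ → ℂ)
      (r' : ↥{f : ℝ → ℂ | ContDiff ℝ 2 f ∧ HasCompactSupport f ∧ tsupport f ⊆ Ioi 0} → PiLp 2 (fun _ : ↥S => ↥(Submodule.span ℂ (Set.range fun _ : Unit => v))))
      (w : ↥{f : ℝ → ℂ | ContDiff ℝ 2 f ∧ HasCompactSupport f ∧ tsupport f ⊆ Ioi 0} → Lp ↥(Submodule.span ℂ (Set.range fun _ : Unit => v)) 2 ((volume : Measure ℝ).restrict (Ioi 0)))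
      (Uiso : ↥(resHBlock L μ ((standardMaximalCompactGL 2 L).comap (adelicVal (↥(maximalRealSubfield L)) L (IsCMField.complexConj L) 2 ((StdForm.antidiagonal 2).over L))) 1 χ) →ₗᵢ[ℂ]
        WithLp 2 (PiLp 2 (fun _ : ↥S => ↥(Submodule.span ℂ (Set.range fun _ : Unit => v))) × Lp ↥(Submodule.span ℂ (Set.range fun _ : Unit => v)) 2 ((volume : Measure ℝ).restrict (Ioi 0)))),
      (∀ z : ℂ, 1 < z.re → s z = (((ν 𝓕).toReal⁻¹ : ℝ) : ℂ) * ((φ 1)⁻¹ * ∫ u : ↥(adelicUnipotent (↥(maximalRealSubfield L)) L (IsCMField.complexConj L) 2), flatSectionU φ z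
        ((quasiSplit (↥(maximalRealSubfield L)) L (IsCMField.complexConj L) 2).toAdelic (weylLongU (IsCMField.complexConj L : L →+* L)
          (rfl : (StdForm.antidiagonal 2).over L = (StdForm.antidiagonal 2).over L)) * ((u : (quasiSplit (↥(maximalRealSubfield L)) L (IsCMField.complexConj L) 2).Adelic) * 1)) ∂ν)) ∧
      MeromorphicNFOn s univ ∧ IsClosed P ∧ (∀ z ∈ P, z.re ≤ 1) ∧ (∀ z : ℂ, z ∉ P → AnalyticAt ℂ s z) ∧
      0 < C ∧
      (∀ c ∈ S, ¬ AnalyticAt ℂ s (c : ℂ) ∧ 1 / 2 < c ∧ c < σ₀) ∧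
      (∀ c ∈ S, Tendsto (fun z : ℂ => (z - c) * s z) (𝓝[≠] (c : ℂ)) (𝓝 (ρ c)) ∧ (ρ c).im = 0 ∧ 0 ≤ (ρ c).re) ∧
      (∀ i j, ⟪r' i, r' j⟫_ℂ = (C : ℂ) * ∑ c ∈ S, ⟪∑ b, mellin ((fun (i : ↥{f : ℝ → ℂ | ContDiff ℝ 2 f ∧ HasCompactSupport f ∧ tsupport f ⊆ Ioi 0}) (_ : Unit) => (i : ℝ → ℂ)) i b) (-(c : ℂ)) • (⟨(fun _ : Unit => v) b, Submodule.subset_span ⟨b, rfl⟩⟩ : ↥(Submodule.span ℂ (Set.range fun _ : Unit => v))),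
        ρ c • ∑ a, mellin ((fun (i : ↥{f : ℝ → ℂ | ContDiff ℝ 2 f ∧ HasCompactSupport f ∧ tsupport f ⊆ Ioi 0}) (_ : Unit) => (i : ℝ → ℂ)) j a) (-(c : ℂ)) • (⟨(fun _ : Unit => v) a, Submodule.subset_span ⟨a, rfl⟩⟩ : ↥(Submodule.span ℂ (Set.range fun _ : Unit => v)))⟫_ℂ) ∧
      (∀ i, (w i : ℝ → ↥(Submodule.span ℂ (Set.range fun _ : Unit => v))) =ᵐ[(volume : Measure ℝ).restrict (Ioi 0)] fun t =>
        (∑ a, mellin ((fun (i : ↥{f : ℝ → ℂ | ContDiff ℝ 2 f ∧ HasCompactSupport f ∧ tsupport f ⊆ Ioi 0}) (_ : Unit) => (i : ℝ → ℂ)) i a) (-((((1 / 2 : ℝ)) : ℂ) + t * I)) • (⟨(fun _ : Unit => v) a, Submodule.subset_span ⟨a, rfl⟩⟩ : ↥(Submodule.span ℂ (Set.range fun _ : Unit => v)))) +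
          s ((((1 / 2 : ℝ)) : ℂ) + ((-t : ℝ) : ℂ) * I) •
            ∑ a, mellin ((fun (i : ↥{f : ℝ → ℂ | ContDiff ℝ 2 f ∧ HasCompactSupport f ∧ tsupport f ⊆ Ioi 0}) (_ : Unit) => (i : ℝ → ℂ)) i a) (-((((1 / 2 : ℝ)) : ℂ) + ((-t : ℝ) : ℂ) * I)) • (⟨(fun _ : Unit => v) a, Submodule.subset_span ⟨a, rfl⟩⟩ : ↥(Submodule.span ℂ (Set.range fun _ : Unit => v)))) ∧
      (∀ i, y i ∈ resHBlock L μ ((standardMaximalCompactGL 2 L).comap (adelicVal (↥(maximalRealSubfield L)) L (IsCMField.complexConj L) 2 ((StdForm.antidiagonal 2).over L))) 1 χ) ∧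
      (∀ i (hi : y i ∈ resHBlock L μ ((standardMaximalCompactGL 2 L).comap (adelicVal (↥(maximalRealSubfield L)) L (IsCMField.complexConj L) 2 ((StdForm.antidiagonal 2).over L))) 1 χ),
        Uiso ⟨y i, hi⟩ = WithLp.toLp 2 (r' i, ((Real.sqrt (C * (2 * π)⁻¹) : ℝ) : ℂ) • w i)) := by
  -- ★ M1 at the rank-one brick family (`α := Unit`, `c := 1`, `f i _ := i`, `y i _ := y i`)
  have hv1 : ∀ a : Unit, (((fun _ : Unit => v) a : Lp ℂ 2 μK) : ↥((standardMaximalCompactGL 2 L).comap (adelicVal (↥(maximalRealSubfield L)) L (IsCMField.complexConj L) 2 ((StdForm.antidiagonal 2).over L)) : Subgroup (quasiSplit (↥(maximalRealSubfield L)) L (IsCMField.complexConj L) 2).Adelic) → ℂ) =ᵐ[μK]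
      fun k => (((fun _ : Unit => (1 : ℂ)) a) • φ) (k : (quasiSplit (↥(maximalRealSubfield L)) L (IsCMField.complexConj L) 2).Adelic) := fun a => by
    simpa only [one_smul] using hv
  have H := exists_linearIsometry_chiSection_selfDual_m1_letterFree_cm_two L μ νG μK νI h𝓕I ν h𝓕N h𝓕1 h𝓕c hβ hμZ hχ hρ hsd hφV hφc hφM hφinf hφ1 hφ1r
    (ι := ↥{f : ℝ → ℂ | ContDiff ℝ 2 f ∧ HasCompactSupport f ∧ tsupport f ⊆ Ioi 0}) (α := Unit) (fun _ : Unit => (1 : ℂ)) (fun _ => one_ne_zero) (fun _ : Unit => v) hv1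
    (f := fun i _ => (i : ℝ → ℂ)) (fun i _ => i.2.1) (fun i _ => i.2.2.1) (fun i _ => i.2.2.2) (fun i _ => y i) (fun i _ => hy i) hσ₀
  obtain ⟨s, P, C, S, ρ, r', w, Uiso, h1, h2, h3, h4, h5, h6, h7, h8, h9, h10, hU⟩ := H
  -- the block of record is the closed span of this family (★ rank one at the maximal level)
  have h0 := topologicalClosure_span_bricks_eq_selfDual L μ hχ hφV hφc hφ1 rfl (fun (i : ↥{f : ℝ → ℂ | ContDiff ℝ 2 f ∧ HasCompactSupport f ∧ tsupport f ⊆ Ioi 0}) (_ : Unit) => y i) (fun i _ => hy i)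
  have heq : resHBlock L μ ((standardMaximalCompactGL 2 L).comap (adelicVal (↥(maximalRealSubfield L)) L (IsCMField.complexConj L) 2 ((StdForm.antidiagonal 2).over L))) 1 χ =
      (Submodule.span ℂ (Set.range fun i : ↥{f : ℝ → ℂ | ContDiff ℝ 2 f ∧ HasCompactSupport f ∧ tsupport f ⊆ Ioi 0} => ∑ a, (fun (i : ↥{f : ℝ → ℂ | ContDiff ℝ 2 f ∧ HasCompactSupport f ∧ tsupport f ⊆ Ioi 0}) (_ : Unit) => y i) i a)).topologicalClosure := by
    rw [resHBlock_def, show ((1 : ↥((standardMaximalCompactGL 2 L).comap (adelicVal (↥(maximalRealSubfield L)) L (IsCMField.complexConj L) 2 ((StdForm.antidiagonal 2).over L)) : Subgroup (quasiSplit (↥(maximalRealSubfield L)) L (IsCMField.complexConj L) 2).Adelic) →* ℂ) :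
      ↥((standardMaximalCompactGL 2 L).comap (adelicVal (↥(maximalRealSubfield L)) L (IsCMField.complexConj L) 2 ((StdForm.antidiagonal 2).over L)) : Subgroup (quasiSplit (↥(maximalRealSubfield L)) L (IsCMField.complexConj L) 2).Adelic) → ℂ) = 1 from rfl]
    exact h0
  have hsum : ∀ i : ↥{f : ℝ → ℂ | ContDiff ℝ 2 f ∧ HasCompactSupport f ∧ tsupport f ⊆ Ioi 0}, (∑ a, (fun (i : ↥{f : ℝ → ℂ | ContDiff ℝ 2 f ∧ HasCompactSupport f ∧ tsupport f ⊆ Ioi 0}) (_ : Unit) => y i) i a) = y i := fun i => Fintype.sum_unique _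
  have hmem : ∀ i, y i ∈ resHBlock L μ ((standardMaximalCompactGL 2 L).comap (adelicVal (↥(maximalRealSubfield L)) L (IsCMField.complexConj L) 2 ((StdForm.antidiagonal 2).over L))) 1 χ := fun i => by
    rw [heq, ← hsum i]
    exact mem_topologicalClosure_span (fun i : ↥{f : ℝ → ℂ | ContDiff ℝ 2 f ∧ HasCompactSupport f ∧ tsupport f ⊆ Ioi 0} => ∑ a, (fun (i : ↥{f : ℝ → ℂ | ContDiff ℝ 2 f ∧ HasCompactSupport f ∧ tsupport f ⊆ Ioi 0}) (_ : Unit) => y i) i a) i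
  refine ⟨s, P, C, S, ρ, r', w, Uiso.comp (LinearIsometryEquiv.ofEq _ _ heq).toLinearIsometry, h1, h2, h3, h4, h5, h6, h7, h8, h9, h10, hmem, fun i hi => ?_⟩
  have hx : (LinearIsometryEquiv.ofEq _ _ heq).toLinearIsometry ⟨y i, hi⟩ =
      ⟨∑ a, (fun (i : ↥{f : ℝ → ℂ | ContDiff ℝ 2 f ∧ HasCompactSupport f ∧ tsupport f ⊆ Ioi 0}) (_ : Unit) => y i) i a, mem_topologicalClosure_span (fun i : ↥{f : ℝ → ℂ | ContDiff ℝ 2 f ∧ HasCompactSupport f ∧ tsupport f ⊆ Ioi 0} => ∑ a, (fun (i : ↥{f : ℝ → ℂ | ContDiff ℝ 2 f ∧ HasCompactSupport f ∧ tsupport f ⊆ Ioi 0}) (_ : Unit) => y i) i a) i⟩ :=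
    Subtype.ext (hsum i).symm
  exact (congrArg Uiso hx).trans (hU i)

end Summit.HodgeConjecture.HodgeConjecture.R90.S8

end
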